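import Mathlib
import HarnessLib
import Summits.AtomisticToContinuum.FouriersLaw.Theses.JunctionLocality
import Summits.AtomisticToContinuum.FouriersLaw.Theorems.JunctionLocalitySuperadditiveResistanceDeviceLiouville
import Literature.MathematicalPhysics.KineticTheory.LangevinChainGibbs
import Literature.MathematicalPhysics.KineticTheory.HeatConductivity

/-!
# WLOG `T = 1` for the far-kick variance floor (helper `helper_varianceFloor_of_unitTemperature` of line
`far-contact-fisher-square`, crux stmt-AtomisticToContinuum-11749 `JunctionLocality.ConductanceLowerBound`) — PROVED

The registered bet of the line asks, for the pinned anharmonic chain `P = pinnedChain ω₂ lam β 1` (unit bath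
coupling), `T > 0`, an `N`-uniform floor `c ≤ (L−1)·V_{L,T}(g)` for every classical mean-zero `C² ∩ L²(μ_T)`
left forward field `g` (`L_{T,T} g = −(p_0² − T)`), where
`V_{L,T}(g) = ∫ dμ_T(x) ∫ d𝒩(0,T)(s) (g(x) − g(q, p[L−1 ↦ s]))²`.  THIS FILE proves the amplitude-scaling
reduction "WLOG `T = 1`": the floor at `(ω₂, lam, β, T)` follows from the floor at `(ω₂, lam·T, β·T, 1)`.

PROOF (Aoki–Lukkarinen–Spohn 2006 §2 scaling, finite chain with baths; the calculus is the tree's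
`Literature/MathematicalPhysics/KineticTheory/HeatConductivity.lean`).  With `S(q,p) = (√T q, √T p)` and
`P' = pinnedChain ω₂ (lam T) (β T) 1`:
(1) `H_P ∘ S = T · H_{P'}` (`hamiltonian_smul`);
(2) `μ^P_T = (μ^{P'}_1) ∘ S⁻¹` (`gibbsMeasure_eq_map_smul`: both are `volume.tilted`, the Lebesgue Jacobian of
    `S` is a constant absorbed by the normalisation, tilting commutes with push-forward along a measurable
    equivalence);
(3) `(L^P_{T,T} f) ∘ S = L^{P'}_{1,1} (f ∘ S)` (`generator_smul`);
(4) for a forward field `g` at temperature `T`, `g' = T⁻¹ · g ∘ S` is a forward field of `P'` at temperature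
    `1` (`C²`, `L²`, mean zero, `L' g' = −(p_0² − 1)`);
(5) `V_{L,T}(g) = T² · V'_{L,1}(g')` (change of variables `x = S x'` outside, `s = √T s'` inside:
    `𝒩(0,T) = 𝒩(0,1) ∘ (√T ·)⁻¹`), so the slice's constant `c` gives `c·T²`, same `L₁`.
No definitions, no named facts, no hypotheses beyond the registered signature.
-/

noncomputable section

open MeasureTheory Filter Topology ProbabilityTheory
open scoped ContDiff NNReal ENNReal
open Literature.MathematicalPhysics.KineticTheory.HeatConduction
open Summit.AtomisticToContinuum.FouriersLaw.Theorems.SuperadditiveResistance.DeviceLiouville (kin kin_eq_sq)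

namespace Summit.AtomisticToContinuum.FouriersLaw.Cruxes.ConductanceLowerBound.FarContactFisherSquare

/-! ### Homogeneity of the generator -/

/-- **Homogeneity of the Langevin generator**: `L (c f) = c L f` (unconditionally; the coordinate
derivatives are one-variable `deriv`s, homogeneous including in the junk case). [folklore] -/
theorem generator_const_mul_apply (P : OscillatorChain) (N : ℕ) (T_L T_R c : ℝ) (f : PhaseSpace N → ℝ)
    (x : PhaseSpace N) :
    P.generator N T_L T_R (fun y => c * f y) x = c * P.generator N T_L T_R f x := by
  -- adapted from `generator_const_mul` (Summits/…/OddSectorIrreversibilityOddDensityIsCorrectorDensity)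
  have hQ : ∀ (φ : PhaseSpace N → ℝ) (i : Fin N) (y : PhaseSpace N),
      partialQ i (fun z => c * φ z) y = c * partialQ i φ y := fun φ i y => by
    unfold partialQ
    exact deriv_const_mul_field c
  have hP : ∀ (φ : PhaseSpace N → ℝ) (i : Fin N) (y : PhaseSpace N),
      partialP i (fun z => c * φ z) y = c * partialP i φ y := fun φ i y => by
    unfold partialP
    exact deriv_const_mul_field c
  have e1 : ∀ i, partialQ i (fun y => c * f y) x = c * partialQ i f x := fun i => hQ f i x
  have e2 : ∀ i y, partialP i (fun y => c * f y) y = c * partialP i f y := fun i y => hP f i y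
  have e3 : ∀ i, partialP i (partialP i (fun y => c * f y)) x = c * partialP i (partialP i f) x := by
    intro i
    have : partialP i (fun y => c * f y) = fun y => c * partialP i f y := funext (e2 i)
    rw [this, hP]
  unfold OscillatorChain.generator
  simp only [e1, e2, e3]
  have hA : (∑ i, (x.2 i * (c * partialQ i f x) - partialQ i (P.hamiltonian N) x * (c * partialP i f x))) =
      c * ∑ i, (x.2 i * partialQ i f x - partialQ i (P.hamiltonian N) x * partialP i f x) := by
    rw [Finset.mul_sum]
    exact Finset.sum_congr rfl fun i _ => by ring
  have hB : (∑ i, ((if i.val = 0 then T_L * (c * partialP i (partialP i f) x) - x.2 i * (c * partialP i f x) else 0) +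
      (if i.val = N - 1 then T_R * (c * partialP i (partialP i f) x) - x.2 i * (c * partialP i f x) else 0))) =
      c * ∑ i, ((if i.val = 0 then T_L * partialP i (partialP i f) x - x.2 i * partialP i f x else 0) +
        (if i.val = N - 1 then T_R * partialP i (partialP i f) x - x.2 i * partialP i f x else 0)) := by
    rw [Finset.mul_sum]
    refine Finset.sum_congr rfl fun i _ => ?_
    split_ifs <;> ring
  rw [hA, hB]
  ring

/-! ### The amplitude scaling `S_s(q,p) = (s q, s p)`, `s² = T`: Gibbs measure, generator, functional -/

section Scaling

variable {L : ℕ}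

/-- **Gibbs measure under the amplitude scaling.** For `s ≠ 0`, `s² = T`:
`μ_T(pinnedChain ω₂ lam β γ) = μ_1(pinnedChain ω₂ (lam T) (β T) γ) ∘ S_s⁻¹` — both are Lebesgue measure tilted by
`−H/T` resp. `−H'`, `H ∘ S_s = T·H'` (`hamiltonian_smul`), the Jacobian `|s|^{-2L}` of Lebesgue measure under `S_s`
is a constant (`Measure.map_addHaar_smul`) absorbed by the normalisation of `Measure.tilted`, and tilting commutes with
the push-forward along the measurable equivalence `S_s`.  (No positivity of `T` needed: `T = s² ≠ 0`.) [folklore] -/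
theorem gibbsMeasure_eq_map_smul (ω₂ lam β γ : ℝ) {T s : ℝ} (hs : s ≠ 0) (hsT : s ^ 2 = T) (L : ℕ) :
    (pinnedChain ω₂ lam β γ).gibbsMeasure L T =
      ((pinnedChain ω₂ (lam * T) (β * T) γ).gibbsMeasure L 1).map fun x => s • x := by
  set e : PhaseSpace L ≃ᵐ PhaseSpace L := MeasurableEquiv.smul₀ s hs with he
  have hecoe : (fun x : PhaseSpace L => s • x) = e := rfl
  haveI : (volume : Measure (PhaseSpace L)).IsAddHaarMeasure :=
    Measure.prod.instIsAddHaarMeasure volume volume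
  set c : ℝ≥0∞ := ENNReal.ofReal |(s ^ Module.finrank ℝ (PhaseSpace L))⁻¹| with hcdef
  have hc0 : c ≠ 0 := by
    rw [hcdef]
    exact (ENNReal.ofReal_pos.mpr (abs_pos.mpr (inv_ne_zero (pow_ne_zero _ hs)))).ne'
  have hctop : c ≠ ⊤ := ENNReal.ofReal_ne_top
  have hvol : (volume : Measure (PhaseSpace L)).map e = c • volume := by
    rw [← hecoe]
    exact Measure.map_addHaar_smul volume hs
  -- tilting forgets the constant Jacobian factor `c` (the normaliser scales by the same factor)
  have htilt_smul : ∀ f : PhaseSpace L → ℝ,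
      (c • (volume : Measure (PhaseSpace L))).tilted f = (volume : Measure (PhaseSpace L)).tilted f := by
    -- adapted from `tilted_of_smul_measure` (Literature/MathematicalPhysics/KineticTheory/InfiniteChainGibbsScaling)
    intro f
    rw [Measure.tilted, Measure.tilted, withDensity_smul_measure, integral_smul_measure,
      ← withDensity_smul' _ _ hctop]
    congr 1
    funext x
    have hrr : 0 < c.toReal := ENNReal.toReal_pos hc0 hctop
    have hr' : c = ENNReal.ofReal c.toReal := (ENNReal.ofReal_toReal hctop).symm
    simp only [Pi.smul_apply, smul_eq_mul]
    generalize hρ : c.toReal = ρ at hrr hr'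
    rw [hr', ← ENNReal.ofReal_mul hrr.le]
    congr 1
    by_cases hZ : (∫ x, Real.exp (f x) ∂(volume : Measure (PhaseSpace L))) = 0
    · simp [hZ]
    · field_simp
  -- tilting commutes with the push-forward along the measurable equivalence `e` (change of variables)
  have htilt_map : ∀ f : PhaseSpace L → ℝ, ((volume : Measure (PhaseSpace L)).map e).tilted f =
      ((volume : Measure (PhaseSpace L)).tilted (f ∘ e)).map e := by
    -- adapted from `tilted_map_equiv` (Literature/MathematicalPhysics/KineticTheory/InfiniteChainGibbsScaling)
    intro f
    ext A hA
    rw [Measure.map_apply e.measurable hA, tilted_apply' _ _ hA,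
      tilted_apply' _ _ (e.measurable hA), integral_map_equiv, Measure.restrict_map e.measurable hA,
      lintegral_map_equiv]
    simp only [Function.comp_apply]
  have hfun : ((fun x : PhaseSpace L => -(pinnedChain ω₂ lam β γ).hamiltonian L x / T) ∘ e) =
      fun x => -(pinnedChain ω₂ (lam * T) (β * T) γ).hamiltonian L x / 1 := by
    have hT : T ≠ 0 := by
      rw [← hsT]
      exact pow_ne_zero 2 hs
    funext x
    rw [Function.comp_apply, ← hecoe]
    dsimp only
    rw [hamiltonian_smul, hsT, div_one, ← mul_neg, mul_div_cancel_left₀ _ hT]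
  rw [OscillatorChain.gibbsMeasure_eq, OscillatorChain.gibbsMeasure_eq, hecoe, ← hfun,
    ← htilt_map, hvol, htilt_smul]

/-- **Generator under the amplitude scaling, unit target temperature.** For `T ≠ 0`, `s ≠ 0`, `s² = T`:
`(L_{T,T} f)(S_s x) = L'_{1,1}(f ∘ S_s)(x)`, `L` the generator of `pinnedChain ω₂ lam β γ` and `L'` that of
`pinnedChain ω₂ (lam T) (β T) γ` (the tree's `generator_smul` with the temperatures `T/s² = 1`). [folklore] -/
theorem generator_smul_unitTemperature (ω₂ lam β γ : ℝ) {T s : ℝ} (hT : T ≠ 0) (hs : s ≠ 0)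
    (hsT : s ^ 2 = T) (f : PhaseSpace L → ℝ) (x : PhaseSpace L) :
    (pinnedChain ω₂ lam β γ).generator L T T f (s • x) =
      (pinnedChain ω₂ (lam * T) (β * T) γ).generator L 1 1 (fun y => f (s • y)) x := by
  have h := generator_smul ω₂ lam β γ hs T T f x
  rw [hsT, div_self hT] at h
  exact h

/-- The far-momentum resampling inside the scaling: `((S_s x).1, (S_s x).2[i ↦ s u]) = S_s (x.1, x.2[i ↦ u])`.
[folklore] -/
theorem smul_update_eq (s : ℝ) (x : PhaseSpace L) (i : Fin L) (u : ℝ) :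
    ((s • x).1, Function.update (s • x).2 i (s * u)) = s • (x.1, Function.update x.2 i u) := by
  rw [Prod.smul_fst, Prod.smul_snd, Prod.smul_mk, ← smul_eq_mul, Function.update_smul]

/-- **The resampling functional under the amplitude scaling.** For `T > 0`, `s ≠ 0`, `s² = T`, any site `i`,
any `g` and any measure `ν` on phase space:
`∫ d(ν∘S_s⁻¹)(x) ∫ d𝒩(0,T)(u) (g x − g(x.1, x.2[i ↦ u]))² = T² ∫ dν(x) ∫ d𝒩(0,1)(u) (g'(x) − g'(x.1, x.2[i ↦ u]))²`
with `g' = T⁻¹ · g ∘ S_s` (change of variables outside, `𝒩(0,T) = 𝒩(0,1) ∘ (s ·)⁻¹` inside; no integrability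
needed: `integral_map_equiv` and pointwise identities). [folklore] -/
theorem resample_functional_smul {T s : ℝ} (hT : 0 < T) (hs : s ≠ 0) (hsT : s ^ 2 = T) (i : Fin L)
    (g : PhaseSpace L → ℝ) (ν : Measure (PhaseSpace L)) :
    ∫ x, (∫ u, (g x - g (x.1, Function.update x.2 i u)) ^ 2 ∂(gaussianReal 0 T.toNNReal))
        ∂(ν.map fun x => s • x) =
      T ^ 2 * ∫ x, (∫ u, (T⁻¹ * g (s • x) - T⁻¹ * g (s • (x.1, Function.update x.2 i u))) ^ 2
        ∂(gaussianReal 0 1)) ∂ν := by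
  have hgauss : gaussianReal 0 T.toNNReal = (gaussianReal 0 1).map (MeasurableEquiv.mulLeft₀ s hs) := by
    rw [MeasurableEquiv.coe_mulLeft₀, gaussianReal_map_const_mul, mul_zero, mul_one]
    congr 1
    ext
    rw [Real.coe_toNNReal _ hT.le, NNReal.coe_mk, hsT]
  have hecoe : (fun x : PhaseSpace L => s • x) = (MeasurableEquiv.smul₀ s hs) := rfl
  rw [hecoe, integral_map_equiv, ← integral_const_mul]
  refine integral_congr_ae (ae_of_all _ fun x => ?_)
  simp only [MeasurableEquiv.coe_smul₀]
  rw [hgauss, integral_map_equiv, ← integral_const_mul]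
  refine integral_congr_ae (ae_of_all _ fun u => ?_)
  simp only [MeasurableEquiv.coe_mulLeft₀]
  rw [smul_update_eq, ← mul_sub, mul_pow, ← mul_assoc, ← mul_pow, mul_inv_cancel₀ hT.ne', one_pow,
    one_mul]

end Scaling

/-! ### The registered helper: WLOG `T = 1` -/

/-- **WLOG `T = 1` FOR THE FAR-KICK VARIANCE FLOOR** (registered helper `helper_varianceFloor_of_unitTemperature`
of line `far-contact-fisher-square`).  If for all `ω₂, lam, β > 0` the unit-temperature variance floor holds for
the left forward fields of `pinnedChain ω₂ lam β 1` (`∃ c > 0 ∃ L₁ ∀ L ≥ L₁ ∀ g`, `c ≤ (L−1)·V_{L,1}(g)`), then the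
floor holds at every temperature `T > 0` (constant `c(ω₂, lam T, β T)·T²`, same `L₁`).  Amplitude scaling
`S(q,p) = (√T q, √T p)`: `H ∘ S = T·H'` with `H'` the Hamiltonian of `pinnedChain ω₂ (lam T) (β T) 1`, so
`μ_T = μ'_1 ∘ S⁻¹`, `(L_{T,T} f) ∘ S = L'_{1,1}(f ∘ S)`; a forward field `g` at `T` gives the forward field
`g' = T⁻¹ g ∘ S` of the rescaled chain at temperature `1`, and `V_{L,T}(g) = T²·V'_{L,1}(g')`
(Aoki–Lukkarinen–Spohn 2006, §2 eqs. (2.8)–(2.13): "the conductivity depends on the anharmonic coupling and the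
temperature only through `λT`"). [folklore] -/
theorem helper_varianceFloor_of_unitTemperature :
    (∀ (ω₂ lam β : ℝ), 0 < ω₂ → 0 < lam → 0 < β →
      ∃ c : ℝ, 0 < c ∧ ∃ L₁ : ℕ, ∀ (L : ℕ) (hL : 2 ≤ L), L₁ ≤ L → ∀ g : PhaseSpace L → ℝ, ContDiff ℝ 2 g →
        MemLp g 2 ((pinnedChain ω₂ lam β 1).gibbsMeasure L 1) →
        ∫ x, g x ∂((pinnedChain ω₂ lam β 1).gibbsMeasure L 1) = 0 →
        (∀ x, (pinnedChain ω₂ lam β 1).generator L 1 1 g x = -(kin L 0 x - 1)) →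
        c ≤ ((L : ℝ) - 1) *
          ∫ x, (∫ s, (g x - g (x.1, Function.update x.2 (⟨L - 1, by omega⟩ : Fin L) s)) ^ 2 ∂(gaussianReal 0 1))
            ∂((pinnedChain ω₂ lam β 1).gibbsMeasure L 1)) →
    ∀ (ω₂ lam β T : ℝ), 0 < ω₂ → 0 < lam → 0 < β → 0 < T →
      ∃ c : ℝ, 0 < c ∧ ∃ L₁ : ℕ, ∀ (L : ℕ) (hL : 2 ≤ L), L₁ ≤ L → ∀ g : PhaseSpace L → ℝ, ContDiff ℝ 2 g →
        MemLp g 2 ((pinnedChain ω₂ lam β 1).gibbsMeasure L T) →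
        ∫ x, g x ∂((pinnedChain ω₂ lam β 1).gibbsMeasure L T) = 0 →
        (∀ x, (pinnedChain ω₂ lam β 1).generator L T T g x = -(kin L 0 x - T)) →
        c ≤ ((L : ℝ) - 1) *
          ∫ x, (∫ s, (g x - g (x.1, Function.update x.2 (⟨L - 1, by omega⟩ : Fin L) s)) ^ 2
              ∂(gaussianReal 0 T.toNNReal)) ∂((pinnedChain ω₂ lam β 1).gibbsMeasure L T) := by
  intro hUnit ω₂ lam β T hω hl hβ hT
  obtain ⟨c, hc, L₁, hfloor⟩ := hUnit ω₂ (lam * T) (β * T) hω (mul_pos hl hT) (mul_pos hβ hT)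
  refine ⟨c * T ^ 2, by positivity, L₁, fun L hL hL1 g hgC hgL2 hg0 hgeq => ?_⟩
  have hL0 : 0 < L := by omega
  obtain ⟨s, hs0, hsT⟩ : ∃ s : ℝ, 0 < s ∧ s ^ 2 = T := ⟨Real.sqrt T, Real.sqrt_pos.mpr hT, Real.sq_sqrt hT.le⟩
  have hs : s ≠ 0 := hs0.ne'
  -- (2) the Gibbs measure at `T` is the push-forward of the rescaled chain's Gibbs measure at `1`
  have hμ : (pinnedChain ω₂ lam β 1).gibbsMeasure L T =
      ((pinnedChain ω₂ (lam * T) (β * T) 1).gibbsMeasure L 1).map fun x => s • x :=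
    gibbsMeasure_eq_map_smul ω₂ lam β 1 hs hsT L
  have hecoe : (fun x : PhaseSpace L => s • x) = (MeasurableEquiv.smul₀ s hs) := rfl
  -- (4) the rescaled field `g' = T⁻¹ · g ∘ S` is a unit-temperature forward field of the rescaled chain
  have hg'C : ContDiff ℝ 2 fun x : PhaseSpace L => T⁻¹ * g (s • x) :=
    contDiff_const.mul (hgC.comp (contDiff_const_smul s))
  have hg'L2 : MemLp (fun x : PhaseSpace L => T⁻¹ * g (s • x)) 2
      ((pinnedChain ω₂ (lam * T) (β * T) 1).gibbsMeasure L 1) := by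
    rw [hμ] at hgL2
    exact (hgL2.comp_of_map (measurable_const_smul s).aemeasurable).const_mul T⁻¹
  have hg'0 : ∫ x, T⁻¹ * g (s • x) ∂((pinnedChain ω₂ (lam * T) (β * T) 1).gibbsMeasure L 1) = 0 := by
    rw [integral_const_mul]
    have h1 : ∫ x, g (s • x) ∂((pinnedChain ω₂ (lam * T) (β * T) 1).gibbsMeasure L 1) =
        ∫ x, g x ∂((pinnedChain ω₂ lam β 1).gibbsMeasure L T) := by
      rw [hμ, hecoe, integral_map_equiv]
      rfl
    rw [h1, hg0, mul_zero]
  have hg'eq : ∀ x, (pinnedChain ω₂ (lam * T) (β * T) 1).generator L 1 1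
      (fun y : PhaseSpace L => T⁻¹ * g (s • y)) x = -(kin L 0 x - 1) := by
    intro x
    have h1 := generator_smul_unitTemperature ω₂ lam β 1 hT.ne' hs hsT g x
    have h2 : (pinnedChain ω₂ (lam * T) (β * T) 1).generator L 1 1 (fun y : PhaseSpace L => T⁻¹ * g (s • y)) x =
        T⁻¹ * (pinnedChain ω₂ (lam * T) (β * T) 1).generator L 1 1 (fun y => g (s • y)) x :=
      generator_const_mul_apply _ L 1 1 T⁻¹ (fun y => g (s • y)) x
    rw [h2, ← h1, hgeq (s • x), kin_eq_sq hL0, kin_eq_sq hL0, Prod.smul_snd, Pi.smul_apply, smul_eq_mul,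
      mul_pow, hsT]
    field_simp
  -- the unit-temperature floor for `g'`
  have hfl := hfloor L hL hL1 (fun x : PhaseSpace L => T⁻¹ * g (s • x)) hg'C hg'L2 hg'0 hg'eq
  beta_reduce at hfl
  -- (5) transport of the functional: `V_{L,T}(g) = T² · V'_{L,1}(g')`
  rw [hμ, resample_functional_smul hT hs hsT]
  have hT2 : 0 ≤ T ^ 2 := by positivity
  refine le_trans (mul_le_mul_of_nonneg_right hfl hT2) (le_of_eq ?_)
  ring

end Summit.AtomisticToContinuum.FouriersLaw.Cruxes.ConductanceLowerBound.FarContactFisherSquare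

end
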